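import Summits.SmoothPoincare4.SmoothPoincare4.Theorems.WeylBudgetBudgetTransferMeasure
import Literature.Geometry.Riemannian.LocalIsometryTransport
import Literature.Geometry.Manifold.SmoothEmbeddingInverse
import Literature.Geometry.Lorentzian.IsometryProofs
import HarnessLib

/-!
# Budget transfer, re-embedding part: integrals over an isometrically re-embedded open piece

Support file (everything proved; no definitions, no named facts) for the support item
`BudgetTransfer` of route WeylBudget (item stmt-SmoothPoincare4-3208). A piece `C` (any model with
corners on the model space `E`) sits in two boundaryless manifolds `P`, `Q` on `E` through a smooth
embedding `j : C → P` and an injective smooth map `k : C → Q` with injective differential, and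
Riemannian metrics `g` on `P`, `γ` on `Q` induce the same piece metric, `j^* g = k^* γ`. On an open
set `U ⊆ range j` of `P` the **re-embedding** `F = k ∘ j⁻¹ : U → Q` is then an injective `C^∞`
local isometry (`reembed_isometry`: chain rule through `j ∘ j⁻¹ = id`), hence a local
diffeomorphism (inverse function theorem), so the change of variables of
`WeylBudgetBudgetTransferMeasure.lean` applies on both sides of the span `P ⊇ U → Q`:

* `setLIntegral_image_eq_of_pullbackBilin_eq` — for `A ⊆ C` with `j(A)` open and functions
  `fQ`, `fP` with `fQ (k c) = fP (j c)` on `C`, **`∫_{k(A)} fQ dV_γ = ∫_{j(A)} fP dV_g`**.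

This is the measure-theoretic half of "an isometric regluing preserves the Weyl energy"
(Lee 2018, Prop. 2.51: isometries preserve the Riemannian volume; Federer 1969, §2.10.11).

## References

* J. M. Lee, *Introduction to Riemannian Manifolds*, 2nd ed. (2018), Prop. 2.51. [Lee2018]
* H. Federer, *Geometric Measure Theory* (1969), §2.10.11. [Federer1969]
* B. O'Neill, *Semi-Riemannian geometry* (1983), Ch. 3, pp. 90–91. [ONeill1983]
-/

noncomputable section

-- the registered namespace `Summit.SmoothPoincare4.SmoothPoincare4.Theorems` repeats a component
set_option linter.dupNamespace false

open Bundle Set Function Filter MeasureTheory Measure Manifold Module Topology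
open scoped Manifold ContDiff Topology

namespace Summit.SmoothPoincare4.SmoothPoincare4.Theorems

namespace BudgetTransfer

open Literature.Geometry.Lorentzian Literature.Geometry.Lorentzian.PseudoRiemannianMetric
open Literature.Geometry.Riemannian Literature.Geometry.Manifold

universe u

/-! ### Set-theoretic facts about the re-embedding `F = k ∘ j⁻¹ ∘ ι` -/

section SetTheory

variable {P : Type*} [TopologicalSpace P] {Q : Type*} {C : Type*} [Nonempty C] {j : C → P} {k : C → Q}

/-- The re-embedding is injective (for injective `k`). [folklore] -/
theorem injective_reembed (hkinj : Injective k)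
    {U : TopologicalSpace.Opens P} (hU : (U : Set P) ⊆ range j) :
    Injective (k ∘ invFun j ∘ (Subtype.val : U → P)) := by
  intro u u' h
  have h1 : invFun j u = invFun j u' := hkinj h
  have h2 : (u : P) = u' := by
    rw [← apply_invFun_subtype_val (f := j) hU u, ← apply_invFun_subtype_val (f := j) hU u', h1]
  exact Subtype.ext h2

/-- The range of the re-embedding on `U = j(A)` is `k(A)` (for injective `j`). [folklore] -/
theorem range_reembed (hjinj : Injective j) {A : Set C}
    {U : TopologicalSpace.Opens P} (hUA : (U : Set P) = j '' A) :
    range (k ∘ invFun j ∘ (Subtype.val : U → P)) = k '' A := by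
  ext y
  constructor
  · rintro ⟨u, rfl⟩
    have hu : (u : P) ∈ j '' A := hUA ▸ u.2
    obtain ⟨a, ha, hau⟩ := hu
    refine ⟨a, ha, ?_⟩
    simp only [Function.comp_apply, ← hau, leftInverse_invFun hjinj a]
  · rintro ⟨a, ha, rfl⟩
    have hmem : j a ∈ (U : Set P) := hUA ▸ mem_image_of_mem j ha
    refine ⟨⟨j a, hmem⟩, ?_⟩
    simp only [Function.comp_apply, leftInverse_invFun hjinj a]

end SetTheory

/-! ### Calculus of the re-embedding -/

section Calculus

variable {E : Type u} [NormedAddCommGroup E] [NormedSpace ℝ E]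
  {HP : Type*} [TopologicalSpace HP] {IP : ModelWithCorners ℝ E HP}
  {P : Type*} [TopologicalSpace P] [ChartedSpace HP P] [IsManifold IP ∞ P]
  {HQ : Type*} [TopologicalSpace HQ] {IQ : ModelWithCorners ℝ E HQ}
  {Q : Type*} [TopologicalSpace Q] [ChartedSpace HQ Q] [IsManifold IQ ∞ Q]
  {HC : Type*} [TopologicalSpace HC] {IC : ModelWithCorners ℝ E HC}
  {C : Type*} [TopologicalSpace C] [ChartedSpace HC C] [Nonempty C]
  {g : PseudoRiemannianMetric IP ∞ E (TangentSpace IP : P → Type _)}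
  {γ : PseudoRiemannianMetric IQ ∞ E (TangentSpace IQ : Q → Type _)}
  {j : C → P} {k : C → Q}

omit [IsManifold IP ∞ P] [IsManifold IQ ∞ Q] in
/-- `F = k ∘ j⁻¹ ∘ ι` is `C^∞` on the open submanifold `U ⊆ range j`. [cite: LeeSmoothManifolds2013, Prop. 4.22] -/
theorem contMDiff_reembed (hj : Manifold.IsSmoothEmbedding IC IP ∞ j) (hk : ContMDiff IC IQ ∞ k)
    {U : TopologicalSpace.Opens P} (hU : (U : Set P) ⊆ range j) :
    ContMDiff IP IQ ∞ (k ∘ invFun j ∘ (Subtype.val : U → P)) :=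
  hk.comp (contMDiff_invFun_comp_subtype_val hj hU)

omit [IsManifold IP ∞ P] [IsManifold IQ ∞ Q] in
/-- The differential of `F = k ∘ j⁻¹ ∘ ι` is `dk ∘ d(j⁻¹ ∘ ι)` (chain rule). [folklore] -/
theorem mfderiv_reembed (hj : Manifold.IsSmoothEmbedding IC IP ∞ j) (hk : ContMDiff IC IQ ∞ k)
    {U : TopologicalSpace.Opens P} (hU : (U : Set P) ⊆ range j) (u : U) :
    mfderiv IP IQ (k ∘ invFun j ∘ (Subtype.val : U → P)) u =
      (mfderiv IC IQ k ((invFun j ∘ (Subtype.val : U → P)) u)).comp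
        (mfderiv IP IC (invFun j ∘ (Subtype.val : U → P)) u) := by
  have h1 : MDifferentiableAt IC IQ k ((invFun j ∘ (Subtype.val : U → P)) u) :=
    (hk _).mdifferentiableAt (by simp)
  have h2 : MDifferentiableAt IP IC (invFun j ∘ (Subtype.val : U → P)) u :=
    (contMDiff_invFun_comp_subtype_val hj hU u).mdifferentiableAt (by simp)
  exact mfderiv_comp u h1 h2

omit [IsManifold IP ∞ P] [IsManifold IQ ∞ Q] in
/-- Pointwise form of `mfderiv_reembed`. [folklore] -/
theorem mfderiv_reembed_apply (hj : Manifold.IsSmoothEmbedding IC IP ∞ j)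
    (hk : ContMDiff IC IQ ∞ k) {U : TopologicalSpace.Opens P} (hU : (U : Set P) ⊆ range j) (u : U)
    (z : TangentSpace IP u) :
    mfderiv IP IQ (k ∘ invFun j ∘ (Subtype.val : U → P)) u z =
      mfderiv IC IQ k ((invFun j ∘ (Subtype.val : U → P)) u)
        (mfderiv IP IC (invFun j ∘ (Subtype.val : U → P)) u z) := by
  rw [mfderiv_reembed hj hk hU u]
  rfl

omit [IsManifold IP ∞ P] [IsManifold IQ ∞ Q] in
/-- `dj ∘ d(j⁻¹ ∘ ι) = id` on `U ⊆ range j` (chain rule on `j ∘ j⁻¹ ∘ ι = ι`, `dι = id`). [folklore] -/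
theorem mfderiv_comp_mfderiv_invFun (hj : Manifold.IsSmoothEmbedding IC IP ∞ j)
    {U : TopologicalSpace.Opens P} (hU : (U : Set P) ⊆ range j) (u : U) (v : TangentSpace IP u) :
    mfderiv IC IP j ((invFun j ∘ (Subtype.val : U → P)) u)
      (mfderiv IP IC (invFun j ∘ (Subtype.val : U → P)) u v) = v := by
  have h1 : MDifferentiableAt IC IP j ((invFun j ∘ (Subtype.val : U → P)) u) :=
    (hj.contMDiff _).mdifferentiableAt (by simp)
  have h2 : MDifferentiableAt IP IC (invFun j ∘ (Subtype.val : U → P)) u :=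
    (contMDiff_invFun_comp_subtype_val hj hU u).mdifferentiableAt (by simp)
  have hcomp : j ∘ (invFun j ∘ (Subtype.val : U → P)) = (Subtype.val : U → P) :=
    funext fun w ↦ apply_invFun_subtype_val hU w
  have hchain := mfderiv_comp u h1 h2
  rw [hcomp, OpenSubmanifold.mfderiv_subtype_val] at hchain
  exact (DFunLike.congr_fun hchain v).symm

/-- **The re-embedding is isometric**: if `j^* g = k^* γ` on `C` then
`γ_{F u}(dF v, dF w) = g_u(v, w)` for `F = k ∘ j⁻¹ ∘ ι` on `U ⊆ range j` (write `v = dj a`,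
`w = dj b` with `a = d(j⁻¹) v`, `b = d(j⁻¹) w`). [cite: ONeill1983, Ch. 3, pp. 90–91] -/
theorem reembed_isometry (hj : Manifold.IsSmoothEmbedding IC IP ∞ j) (hk : ContMDiff IC IQ ∞ k)
    (hiso : ∀ c, pullbackBilin (I := IP) (I' := IC) j g.val c =
      pullbackBilin (I := IQ) (I' := IC) k γ.val c)
    {U : TopologicalSpace.Opens P} (hU : (U : Set P) ⊆ range j) (u : U) (v w : TangentSpace IP u) :
    γ.val ((k ∘ invFun j ∘ (Subtype.val : U → P)) u)
        (mfderiv IP IQ (k ∘ invFun j ∘ (Subtype.val : U → P)) u v)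
        (mfderiv IP IQ (k ∘ invFun j ∘ (Subtype.val : U → P)) u w) =
      g.val u.1 (mfderiv IP IP (Subtype.val : U → P) u v)
        (mfderiv IP IP (Subtype.val : U → P) u w) := by
  have hval : ∀ z : TangentSpace IP u, mfderiv IP IP (Subtype.val : U → P) u z = z := fun z ↦ by
    rw [OpenSubmanifold.mfderiv_subtype_val]; rfl
  rw [mfderiv_reembed_apply hj hk hU u v, mfderiv_reembed_apply hj hk hU u w, hval v, hval w]
  have h := congrArg (fun b ↦ b (mfderiv IP IC (invFun j ∘ (Subtype.val : U → P)) u v)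
    (mfderiv IP IC (invFun j ∘ (Subtype.val : U → P)) u w))
    (hiso ((invFun j ∘ (Subtype.val : U → P)) u))
  simp only [pullbackBilin_apply] at h
  rw [mfderiv_comp_mfderiv_invFun hj hU u v, mfderiv_comp_mfderiv_invFun hj hU u w] at h
  have hjc : j ((invFun j ∘ (Subtype.val : U → P)) u) = u.1 := apply_invFun_subtype_val hU u
  rw [hjc] at h
  exact h.symm

omit [IsManifold IP ∞ P] [IsManifold IQ ∞ Q] in
/-- The re-embedding has injective differential. [folklore] -/
theorem injective_mfderiv_reembed (hj : Manifold.IsSmoothEmbedding IC IP ∞ j)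
    (hk : ContMDiff IC IQ ∞ k) (hk' : ∀ c, Injective (mfderiv IC IQ k c))
    {U : TopologicalSpace.Opens P} (hU : (U : Set P) ⊆ range j) (u : U) :
    Injective (mfderiv IP IQ (k ∘ invFun j ∘ (Subtype.val : U → P)) u) := by
  rw [mfderiv_reembed hj hk hU u]
  exact (hk' _).comp (injective_mfderiv_invFun_comp_subtype_val hj (by simp) hU u)

end Calculus

/-! ### The re-embedding is a local diffeomorphism -/

section LocalDiffeo

variable {E : Type u} [NormedAddCommGroup E] [NormedSpace ℝ E] [FiniteDimensional ℝ E]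
  [CompleteSpace E]
  {HP : Type*} [TopologicalSpace HP] {IP : ModelWithCorners ℝ E HP} [IP.Boundaryless]
  {P : Type*} [TopologicalSpace P] [ChartedSpace HP P] [IsManifold IP ∞ P]
  {HQ : Type*} [TopologicalSpace HQ] {IQ : ModelWithCorners ℝ E HQ} [IQ.Boundaryless]
  {Q : Type*} [TopologicalSpace Q] [ChartedSpace HQ Q] [IsManifold IQ ∞ Q]
  {HC : Type*} [TopologicalSpace HC] {IC : ModelWithCorners ℝ E HC}
  {C : Type*} [TopologicalSpace C] [ChartedSpace HC C] [Nonempty C]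
  {j : C → P} {k : C → Q}

/-- The re-embedding is a local diffeomorphism at every point (inverse function theorem: smooth
with injective differential between manifolds on the same model space, boundaryless models).
[cite: LeeSmoothManifolds2013, Thm. 4.5] -/
theorem isLocalDiffeomorph_reembed (hj : Manifold.IsSmoothEmbedding IC IP ∞ j)
    (hk : ContMDiff IC IQ ∞ k) (hk' : ∀ c, Injective (mfderiv IC IQ k c))
    {U : TopologicalSpace.Opens P} (hU : (U : Set P) ⊆ range j) :
    IsLocalDiffeomorph IP IQ ∞ (k ∘ invFun j ∘ (Subtype.val : U → P)) := fun u ↦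
  isLocalDiffeomorphAt_of_injective isOpen_univ (mem_univ u)
    (contMDiff_reembed hj hk hU).contMDiffOn (injective_mfderiv_reembed hj hk hk' hU u)

/-- The inclusion of an open submanifold is a local diffeomorphism. [folklore] -/
theorem isLocalDiffeomorph_subtype_val (U : TopologicalSpace.Opens P) :
    IsLocalDiffeomorph IP IP ∞ (Subtype.val : U → P) := fun u ↦
  isLocalDiffeomorphAt_of_injective isOpen_univ (mem_univ u) contMDiff_subtype_val.contMDiffOn
    (by rw [OpenSubmanifold.mfderiv_subtype_val]; exact fun v w h ↦ h)

end LocalDiffeo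

/-! ### Integrals over the re-embedded piece -/

section Integral

variable {E : Type u} [NormedAddCommGroup E] [NormedSpace ℝ E] [FiniteDimensional ℝ E]
  [CompleteSpace E]
  {HP : Type*} [TopologicalSpace HP] {IP : ModelWithCorners ℝ E HP} [IP.Boundaryless]
  {P : Type*} [TopologicalSpace P] [ChartedSpace HP P] [IsManifold IP ∞ P]
  [T3Space P] [MeasurableSpace P] [BorelSpace P] [SecondCountableTopology P]
  {HQ : Type*} [TopologicalSpace HQ] {IQ : ModelWithCorners ℝ E HQ} [IQ.Boundaryless]
  {Q : Type*} [TopologicalSpace Q] [ChartedSpace HQ Q] [IsManifold IQ ∞ Q]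
  [T3Space Q] [MeasurableSpace Q] [BorelSpace Q]
  {HC : Type*} [TopologicalSpace HC] {IC : ModelWithCorners ℝ E HC}
  {C : Type*} [TopologicalSpace C] [ChartedSpace HC C] [Nonempty C]
  {g : PseudoRiemannianMetric IP ∞ E (TangentSpace IP : P → Type _)}
  {γ : PseudoRiemannianMetric IQ ∞ E (TangentSpace IQ : Q → Type _)}
  {j : C → P} {k : C → Q}

/-- **Integrals over an isometrically re-embedded open piece agree.** Let `j : C → P` be a
smooth embedding and `k : C → Q` an injective smooth map with injective differential (`P`, `Q`
boundaryless manifolds on the model space of `C`), `g`, `γ` Riemannian metrics on `P`, `Q` with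
`j^* g = k^* γ`, and `A ⊆ C` with `j(A)` open in `P`. If `fQ (k c) = fP (j c)` for all `c`, then
`∫_{k(A)} fQ dV_γ = ∫_{j(A)} fP dV_g`. Proof: with `U = j(A)` and the restricted metric
`g|_U = ι^* g`, the re-embedding `F = k ∘ j⁻¹ : U → Q` and the inclusion `ι : U → P` are injective
`C^∞` local isometries, so both sides equal `∫_U (fP ∘ ι) dV_{g|_U}`
(`setLIntegral_range_of_localIsometry`). [cite: Lee2018, Prop. 2.51] [cite: Federer1969, §2.10.11] -/
theorem setLIntegral_image_eq_of_pullbackBilin_eq (hg : g.IsRiemannian) (hγ : γ.IsRiemannian)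
    (hj : Manifold.IsSmoothEmbedding IC IP ∞ j) (hk : ContMDiff IC IQ ∞ k)
    (hk' : ∀ c, Injective (mfderiv IC IQ k c)) (hkinj : Injective k)
    (hiso : ∀ c, pullbackBilin (I := IP) (I' := IC) j g.val c =
      pullbackBilin (I := IQ) (I' := IC) k γ.val c)
    {A : Set C} (hA : IsOpen (j '' A)) {fQ : Q → ENNReal} {fP : P → ENNReal}
    (hf : ∀ c, fQ (k c) = fP (j c)) :
    ∫⁻ y in k '' A, fQ y ∂(riemannianMeasure (γ.toContMDiffRiemannianMetric hγ)) =
      ∫⁻ x in j '' A, fP x ∂(riemannianMeasure (g.toContMDiffRiemannianMetric hg)) := by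
  set U : TopologicalSpace.Opens P := ⟨j '' A, hA⟩ with hUdef
  have hUA : (U : Set P) = j '' A := rfl
  have hU : (U : Set P) ⊆ range j := by rw [hUA]; exact image_subset_range j A
  letI : MeasurableSpace U := borel U
  haveI : BorelSpace U := ⟨rfl⟩
  -- the restricted metric `g|_U = ι^* g`
  have hι : ContMDiff IP IP (((⊤ : ℕ∞) : ℕ∞ω) + 1) (Subtype.val : U → P) := contMDiff_subtype_val
  have hι' : ∀ u : U, Injective (mfderiv IP IP (Subtype.val : U → P) u) := fun u ↦ by
    rw [OpenSubmanifold.mfderiv_subtype_val]; exact fun v w h ↦ h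
  set gU := g.comap (contMDiff_pullbackBilin_holds (I := IP) (M := P) (I' := IP) (N := U))
    Subtype.val hι hι' rfl with hgU
  have hgUR : gU.IsRiemannian := fun u v hv ↦ by
    simp only [hgU, val_comap, pullbackBilin_apply, OpenSubmanifold.mfderiv_subtype_val]
    exact hg u.1 v hv
  -- the re-embedding `F = k ∘ j⁻¹ ∘ ι`
  set F : U → Q := k ∘ invFun j ∘ (Subtype.val : U → P) with hF
  have hFs : ContMDiff IP IQ ∞ F := contMDiff_reembed hj hk hU
  have hFinj : Injective F := injective_reembed hkinj hU
  have hFloc : IsLocalDiffeomorph IP IQ ∞ F := isLocalDiffeomorph_reembed hj hk hk' hU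
  have hFiso : ∀ (u : U) (v w : TangentSpace IP u),
      γ.val (F u) (mfderiv IP IQ F u v) (mfderiv IP IQ F u w) = gU.val u v w := fun u v w ↦ by
    rw [hgU, val_comap, pullbackBilin_apply]
    exact reembed_isometry hj hk hiso hU u v w
  have h1 := setLIntegral_range_of_localIsometry hgUR hγ hFs hFinj hFloc hFiso rfl fQ
  rw [range_reembed hj.isEmbedding.injective hUA] at h1
  -- the inclusion `ι : U → P`
  have hιs : ContMDiff IP IP ∞ (Subtype.val : U → P) := contMDiff_subtype_val
  have hιiso : ∀ (u : U) (v w : TangentSpace IP u),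
      g.val (Subtype.val u) (mfderiv IP IP (Subtype.val : U → P) u v)
        (mfderiv IP IP (Subtype.val : U → P) u w) = gU.val u v w := fun u v w ↦ by
    rw [hgU, val_comap, pullbackBilin_apply]
  have h2 := setLIntegral_range_of_localIsometry hgUR hg hιs Subtype.val_injective
    (isLocalDiffeomorph_subtype_val U) hιiso rfl fP
  rw [Subtype.range_val] at h2
  rw [h1, show ((U : TopologicalSpace.Opens P) : Set P) = j '' A from rfl] at *
  rw [h2]
  refine lintegral_congr fun u ↦ ?_
  show fQ (k (invFun j (u : P))) = fP (u : P)
  rw [hf, apply_invFun_subtype_val hU u]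

end Integral

end BudgetTransfer

end Summit.SmoothPoincare4.SmoothPoincare4.Theorems

end
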